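import Literature.AlgebraicGeometry.Deformation.PerfectComplexOnSNC
import HarnessLib

/-!
# Exact equivalences of derived categories of perfect complexes, shifts and sheaves in degree zero, AS PRINTED
# (Orlov 2002 §§1–2; Mukai 1981 p. 156), over the tree's posited perfect complexes

Layer `Literature/AlgebraicGeometry/AbelianVarieties`. Typed for the venture cell `pub-hsemireg`
(amplification chain, seat p6). The one categorical fact that chain uses about the Fourier–Mukai type
functors it meets (Mukai's `RŜ`, Orlov's `Φ_{S_A}` and its inverse = the `Φ : D^b(X×X) ⥲ D^b(X×X̂)` of
Markman's secant construction, `Rf_*` for an automorphism `f`, `– ⊗ L` for a line bundle `L`): an EXACT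
EQUIVALENCE of derived categories preserves every `Extⁱ` and hence the gluability condition
`Ext^{<0} = 0`; in particular the image of a SHEAF under an exact equivalence is gluable. Companion file:
`MukaiFourierDuality.lean` (Mukai's Thm. 2.2, W.I.T./I.T.). HONEST FRAMING: nothing here is about any
explicit variety; nothing here says that HC, HC_CM or HC_AV holds.

## Sources, verbatim (`pNNNN:Lnn` = line of the held text)

* [Orlov2002DerivedAbelian] D. Orlov, *Derived categories of coherent sheaves on abelian varieties and
  equivalences between them*, Izv. Math. 66 (2002) 569–594 (= alg-geom/9712017, held as
  `paper:arxiv-alg-geom_9712017`, numbering of the arXiv text). p. 3 L26–31 (Thm. 1.4, setting): "Let `X`,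
  `Y` be smooth projective varieties. Suppose that `F : D^b(X) ⥲ D^b(Y)` is an exact functor and an
  equivalence of triangulated categories"; p. 3 L33–40: "To verify that a functor `F` is an equivalence, it
  suffices to show that `F` and its right (or left) adjoint functor are fully faithful. We recall that a
  functor `F` is fully faithful if, for any objects `A` and `B`, the natural map `Hom(A, B) → Hom(F(A), F(B))`
  is a bijection"; **Assertion 1.7** (p. 3 L126–136): "assume that the functors `Φ_{ℰ₁}` and `Φ_{ℰ₂}` are
  fully faithful (resp. equivalences). Then the functor `Φ_{ℰ₁ ⊠ ℰ₂} : D^b(X₁ × X₂) → D^b(Y₁ × Y₂)` is also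
  fully faithful (resp. an equivalence)"; **Prop. 2.4** [Mukai]: "Let `P` be the Poincaré bundle on
  `A × Â`. Then the functor `Φ_P : D^b(A) → D^b(Â)` is an exact equivalence, and there is an isomorphism of
  functors `Ψ_P ∘ Φ_P ≅ (−1_A)^*[n]`"; **Def. 2.6**: "The functor `Φ_{S_A}` is the composite
  `Rμ_{A*} ∘ Φ_{𝒫_A}`" (`Φ_{𝒫_A} : D^b(A × Â) → D^b(A × A)`, `𝒫_A = p_{14}^*𝒪_Δ ⊗ p_{23}^*P`,
  `μ_A(a₁, a₂) = (a₁, m(a₁, a₂))`); **Assertion 2.8**: "The functor `Φ_{S_A}` is an equivalence" (proof: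
  "`Φ_{S_A}` is the composite of the functors `Rμ_{A*}` and `Φ_{𝒫_A}`, which are equivalences. (This is
  obvious for the first functor, and this follows from Assertion 1.7 and Proposition 2.4 for the second
  one.)"); p. 3 L9: an automorphism `f : X → X` "induces the autoequivalence `Rf_*`".
* [Mukai1981] S. Mukai, Nagoya Math. J. 81 (1981) (open access; cell copy and locator check
  `run/shared/lean/pub/pub-hsemireg/lit/Mukai1981-NMJ81/`, `MUKAI1981-LOCATORS.md`), p. 156 L25–27: "We always
  identify [an] `𝒪_X`-module `F` with the complex consisting of `F` in degree `0`, and `0` elsewhere"; Thm. 2.2: "`[−g]` denotes 'shift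
  the complex `g` places to the right'"; p. 157 L1–4 (proof of Cor. 2.5):
  `Extⁱ_{𝒪_X}(F, G) ≅ Hom_{D(X)}(F, G[i]) ≅ Hom_{D(X̂)}(F̂[−i(F)], Ĝ[i − i(G)]) ≅ Ext^{i+μ}_{𝒪_X̂}(F̂, Ĝ)`.
* [Lieblich2006] M. Lieblich, *Moduli of complexes on a proper morphism*, Prop. 2.1.9: universal
  gluability `⟺ Ext^{-i}(E_s, E_s) = 0` for all `i > 0` — the tree's `PerfectComplexOnSNC.IsGluable`.

## Content and design (D-0014/D-0019: real where the tree has the notion, posited data elsewhere)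

Mathlib (this pin) has derived categories of an abelian category but no perfect complexes on schemes, no
derived pull-back/push-forward and no derived tensor product, so none of the functors above can be
CONSTRUCTED. Following the tree's idiom (`Deformation.PerfectComplexData`, `Deformation.PerfectComplexOnSNC`,
`HodgeTheory.ChernCharacterBetti`) this file provides HYPOTHESIS STRUCTURES over the tree's posited carrier
`D : PerfectComplexOnSNC` (types `D.Perf Y` of perfect complexes up to isomorphism, derived pull-backs
`D.pull`, `ℂ`-vector spaces `D.Ext n E F`, `n : ℤ`, gluability `D.IsGluable`, the structure sheaf
`D.unitOver Y`), consumed as PARAMETERS: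

* `DerivedShiftData D` — the shift `E ↦ E[a]` and "a module is the complex with it in degree `0`"
  (`ofModule`), with exactly the bookkeeping Mukai's and Orlov's statements use: `E[0] = E`,
  `E[b][a] = E[a+b]`, `Lf^*` commutes with shifts, `Extⁿ(E[a], F[b]) ≅ Ext^{n−a+b}(E, F)`
  (`Extⁿ(A, B) = Hom(A, B[n])`), isomorphic modules give the same object, `𝒪_Y` in degree `0` is the
  carrier's `𝒪_Y`, `Lf^*F = f^*F` along ISOMORPHISMS `f`, and a module has no negative self-extensions.
* `PerfEquivalence D T Y₁ Y₂` — an EXACT EQUIVALENCE `Φ : D(Y₁) ⥲ D(Y₂)` at the level the carrier sees: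
  a bijection on isomorphism classes commuting with shifts, with the bijections `Extⁿ(E, F) ≅ Extⁿ(ΦE, ΦF)`
  (full faithfulness applied to `B[n]`). PROVED: `toEquiv`, `symm`, `trans`, `refl`, `finrank_ext_eq`,
  `subsingleton_ext_iff`, `isGluable_iff`, **`isGluable_ofModule`** (the image of a sheaf under an exact
  equivalence has `Ext^{<0} = 0` — the sentence the cell uses for its secant object `E₀ = Φ(I_Z)`),
  `finrank_ext_ofModule` (`dim Extⁱ(ΦF, ΦF) = dim Extⁱ(F, F)`).

SCOPE. (S1) The carrier is a SET of isomorphism classes with `Ext` groups: "exact equivalence" is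
rendered on objects, shifts and `Ext`, not as a functor with natural isomorphisms. (S2) INTENDED
INSTANCES are documented, not constructed, and there is deliberately NO named existence fact (D-0026):
consumers take `(Φ : PerfEquivalence D T Y₁ Y₂)` as a parameter — for the cell: Orlov's `Φ_{S_X}⁻¹`
on `X × X → X × X̂` (Assertion 2.8), `– ⊗ M_B` (a line bundle), and their composite. (S3) NOT typed:
Orlov's representability Thm. 1.4, the box-product formula (1.4), Assertion 2.8 (a)–(b) (values on
skyscrapers and on `P_{(α,a)}`), §§3–5 (the group `U(A × Â)`, autoequivalences).
-/

noncomputable section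

open CategoryTheory CategoryTheory.Limits AlgebraicGeometry

namespace Literature.AlgebraicGeometry.AbelianVarieties

open Literature.AlgebraicGeometry.Motives (SchemeOver)
open Literature.AlgebraicGeometry.Deformation (PerfectComplexOnSNC structureSheafModule)

variable {D : PerfectComplexOnSNC}

/-! ## Shift and modules-in-degree-zero on the posited perfect complexes -/

/-- **Shift and heart on the posited perfect complexes** (hypothesis structure over
`D : PerfectComplexOnSNC`, D-0014/D-0019). Data: the shift `shift a E = E[a]` ("`[−g]` denotes 'shift the
complex `g` places to the right'") and `ofModule F`, the `𝒪_Y`-module `F` regarded as a complex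
concentrated in degree `0` ("We always identify [an] `𝒪_X`-module `F` with the complex consisting of `F`
in degree `0`, and `0` elsewhere"; meaningful for coherent `F` on smooth `Y`, where `F` is perfect).
Properties: `E[0] = E`, `E[b][a] = E[a+b]`, `Lf^*(E[a]) = (Lf^*E)[a]`,
`Extⁿ(E[a], F[b]) ≅ Ext^{n−a+b}(E, F)` (`Hom(E[a], F[b][n]) = Hom(E, F[n−a+b])`), isomorphic modules give
the same object, `𝒪_Y` in degree `0` is the carrier's `𝒪_Y`, `Lf^*F = f^*F` for an ISOMORPHISM `f`
(flat), and a module has no negative self-extensions (`Ext^{<0}` vanishes on the heart).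
POSITED bookkeeping of the standard triangulated structure (folklore); Lieblich's Prop. 2.1.9 supplies the NAME
«(universally) gluable» for the last clause, whose content is the folklore vanishing of negative `Ext` on the
heart. [cite: Mukai1981, p. 156 Thm. 2.2 and L25–27] [cite: Lieblich2006, Prop. 2.1.9] -/
structure DerivedShiftData (D : PerfectComplexOnSNC) where
  /-- The shift `E ↦ E[a]`, `a : ℤ`. [cite: Mukai1981, p. 156 (Thm. 2.2, "[−g]")] -/
  shift : ∀ {Y : SchemeOver ℂ}, ℤ → D.Perf Y → D.Perf Y
  /-- `E[0] = E`. [folklore] -/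
  shift_zero : ∀ {Y : SchemeOver ℂ} (E : D.Perf Y), shift 0 E = E
  /-- `E[b][a] = E[a + b]`. [folklore] -/
  shift_shift : ∀ {Y : SchemeOver ℂ} (a b : ℤ) (E : D.Perf Y), shift a (shift b E) = shift (a + b) E
  /-- `Lf^*(E[a]) = (Lf^*E)[a]` (derived pull-back is an exact functor). [folklore] -/
  pull_shift : ∀ {Y Y' : SchemeOver ℂ} (f : Y' ⟶ Y) (a : ℤ) (E : D.Perf Y),
    D.pull f (shift a E) = shift a (D.pull f E)
  /-- `Extⁿ(E[a], F[b]) ≅ Ext^{n−a+b}(E, F)`, `ℂ`-linearly (`Extⁿ(A, B) = Hom(A, B[n])`).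
  [cite: Mukai1981, p. 157 L1–4 (proof of Cor. 2.5)] -/
  extShift : ∀ {Y : SchemeOver ℂ} (n a b : ℤ) (E F : D.Perf Y),
    D.Ext n (shift a E) (shift b F) ≃ₗ[ℂ] D.Ext (n - a + b) E F
  /-- `ofModule F`: the module `F` as a complex in degree `0`. [cite: Mukai1981, p. 156 L25–27] -/
  ofModule : ∀ {Y : SchemeOver ℂ}, Y.left.Modules → D.Perf Y
  /-- Isomorphic modules define the same (isomorphism class of) complex. [folklore] -/
  ofModule_congr : ∀ {Y : SchemeOver ℂ} {F G : Y.left.Modules}, (F ≅ G) → ofModule F = ofModule G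
  /-- `𝒪_Y` in degree `0` is the carrier's structure sheaf `D.unitOver Y`. [folklore] -/
  ofModule_structureSheaf : ∀ (Y : SchemeOver ℂ), ofModule (structureSheafModule Y.left) = D.unitOver Y
  /-- `Lf^*F = f^*F` for an isomorphism `f` (isomorphisms are flat). [folklore] -/
  pull_ofModule : ∀ {Y Y' : SchemeOver ℂ} (f : Y' ⟶ Y) [IsIso f] (F : Y.left.Modules),
    D.pull f (ofModule F) = ofModule ((Scheme.Modules.pullback f.left).obj F)
  /-- A module has no negative self-extensions: `Extⁿ(F, F) = 0` for `n < 0` (folklore: objects of the heart;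
  Lieblich names the condition «gluable»). [cite: Lieblich2006, Def. 2.1.8 and Prop. 2.1.9] -/
  isGluable_ofModule : ∀ {Y : SchemeOver ℂ} (F : Y.left.Modules), D.IsGluable (ofModule F)

namespace DerivedShiftData

variable (T : DerivedShiftData D) {Y : SchemeOver ℂ}

/-- `E[a][−a] = E`. [folklore] -/
private theorem shift_neg_shift (a : ℤ) (E : D.Perf Y) : T.shift (-a) (T.shift a E) = E := by
  rw [T.shift_shift, neg_add_cancel, T.shift_zero]

/-- `E[−a][a] = E`. [folklore] -/
private theorem shift_shift_neg (a : ℤ) (E : D.Perf Y) : T.shift a (T.shift (-a) E) = E := by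
  rw [T.shift_shift, add_neg_cancel, T.shift_zero]

/-- The shift is injective on isomorphism classes. [folklore] -/
private theorem shift_injective (a : ℤ) : Function.Injective (T.shift (Y := Y) a) := fun E F h => by
  rw [← T.shift_neg_shift a E, h, T.shift_neg_shift]

end DerivedShiftData

/-- Transport of `Extⁿ` along EQUALITIES of (isomorphism classes of) objects — bookkeeping used to read a
field equation `Φ E = F[a]` inside an `Ext` group. [folklore] -/
def extCongr {Y : SchemeOver ℂ} (n : ℤ) {A A' B B' : D.Perf Y} (hA : A = A') (hB : B = B') :
    D.Ext n A B ≃ₗ[ℂ] D.Ext n A' B' := by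
  subst hA hB
  exact LinearEquiv.refl ℂ _

/-- Transport of `Extⁿ` along an equality of degrees `n = n'`. [folklore] -/
def extDegCongr {Y : SchemeOver ℂ} {n n' : ℤ} (h : n = n') (A B : D.Perf Y) :
    D.Ext n A B ≃ₗ[ℂ] D.Ext n' A B := by
  subst h
  exact LinearEquiv.refl ℂ _

/-! ## Exact equivalences, at the level of isomorphism classes and `Ext` groups -/

/-- **An exact equivalence `Φ : D(Y₁) ⥲ D(Y₂)`** of derived categories of perfect complexes, as seen by the
posited carrier (hypothesis structure, D-0014/D-0019): a bijection on isomorphism classes of objects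
(`toFun`, `invFun`) commuting with shifts (exactness), and for all objects the bijections
`Extⁿ(E, F) ≅ Extⁿ(ΦE, ΦF)` ("a functor `F` is fully faithful if, for any objects `A` and `B`, the natural
map `Hom(A, B) → Hom(F(A), F(B))` is a bijection", applied to `B[n]`). Intended instances: Mukai's
`RŜ : D(X) ⥲ D(X̂)` (Thm. 2.2; `MukaiFourierDuality.perfEquivalence` below), Orlov's
`Φ_{S_A} = Rμ_{A*} ∘ Φ_{𝒫_A} : D^b(A × Â) ⥲ D^b(A × A)` and its inverse (Def. 2.6, Assertion 2.8, via
Prop. 2.4 and Assertion 1.7 — the functor written `Φ : D^b(X×X) ⥲ D^b(X×X̂)` in Markman's secant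
construction), `Rf_*` for an automorphism `f`, and `– ⊗ L` for a line bundle `L` (inverse `– ⊗ L⁻¹`).
[cite: Orlov2002DerivedAbelian, p. 3 L28–40, Assertion 1.7, Def. 2.6 and Assertion 2.8]
[cite: Mukai1981, Thm. 2.2] -/
structure PerfEquivalence (D : PerfectComplexOnSNC) (T : DerivedShiftData D) (Y₁ Y₂ : SchemeOver ℂ) where
  /-- `Φ` on (isomorphism classes of) objects. -/
  toFun : D.Perf Y₁ → D.Perf Y₂
  /-- A quasi-inverse `Φ⁻¹` on objects. -/
  invFun : D.Perf Y₂ → D.Perf Y₁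
  /-- `Φ⁻¹(Φ E) ≅ E`. [cite: Orlov2002DerivedAbelian, p. 3 L28–31] -/
  left_inv : ∀ E, invFun (toFun E) = E
  /-- `Φ(Φ⁻¹ F) ≅ F`. [cite: Orlov2002DerivedAbelian, p. 3 L28–31] -/
  right_inv : ∀ F, toFun (invFun F) = F
  /-- Exactness: `Φ(E[a]) ≅ (ΦE)[a]`. [cite: Orlov2002DerivedAbelian, p. 3 L28–31 ("exact functor")] -/
  map_shift : ∀ (a : ℤ) (E : D.Perf Y₁), toFun (T.shift a E) = T.shift a (toFun E)
  /-- Full faithfulness: `Extⁿ(E, F) ≅ Extⁿ(ΦE, ΦF)`, `ℂ`-linearly.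
  [cite: Orlov2002DerivedAbelian, p. 3 L33–40] -/
  extMap : ∀ (n : ℤ) (E F : D.Perf Y₁), D.Ext n E F ≃ₗ[ℂ] D.Ext n (toFun E) (toFun F)

namespace PerfEquivalence

variable {T : DerivedShiftData D} {Y₁ Y₂ Y₃ : SchemeOver ℂ} (Φ : PerfEquivalence D T Y₁ Y₂)

/-- The bijection on isomorphism classes of objects underlying an exact equivalence.
[cite: Orlov2002DerivedAbelian, p. 3 L28–31] -/
def toEquiv : D.Perf Y₁ ≃ D.Perf Y₂ where
  toFun := Φ.toFun
  invFun := Φ.invFun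
  left_inv := Φ.left_inv
  right_inv := Φ.right_inv

/-- An exact equivalence preserves the dimension of every `Extⁿ`. [cite: Orlov2002DerivedAbelian, p. 3 L33–40] -/
theorem finrank_ext_eq (n : ℤ) (E F : D.Perf Y₁) :
    Module.finrank ℂ (D.Ext n (Φ.toFun E) (Φ.toFun F)) = Module.finrank ℂ (D.Ext n E F) :=
  (Φ.extMap n E F).finrank_eq.symm

/-- `Extⁿ(ΦE, ΦF) = 0 ↔ Extⁿ(E, F) = 0`. [cite: Orlov2002DerivedAbelian, p. 3 L33–40] -/
theorem subsingleton_ext_iff (n : ℤ) (E F : D.Perf Y₁) :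
    Subsingleton (D.Ext n (Φ.toFun E) (Φ.toFun F)) ↔ Subsingleton (D.Ext n E F) :=
  ⟨fun _ => (Φ.extMap n E F).toEquiv.subsingleton, fun _ => (Φ.extMap n E F).symm.toEquiv.subsingleton⟩

/-- **Gluability is transported by exact equivalences**: `Ext^{<0}(ΦE, ΦE) = 0 ↔ Ext^{<0}(E, E) = 0`.
[cite: Lieblich2006, Prop. 2.1.9] [cite: Orlov2002DerivedAbelian, p. 3 L33–40] -/
theorem isGluable_iff (E : D.Perf Y₁) : D.IsGluable (Φ.toFun E) ↔ D.IsGluable E :=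
  forall₂_congr fun n _ => Φ.subsingleton_ext_iff n E E

/-- **The image of a sheaf under an exact equivalence is gluable** ("`Ext^{<0}(E₀, E₀) = 0` because `E₀`
is the image of a coherent sheaf under a derived equivalence" — the sentence used for the secant object
`E₀ = Φ(I_{p×X ∪ X×q})`). [cite: Lieblich2006, Prop. 2.1.9] [cite: Orlov2002DerivedAbelian, Assertion 2.8] -/
theorem isGluable_ofModule (F : Y₁.left.Modules) : D.IsGluable (Φ.toFun (T.ofModule F)) :=
  (Φ.isGluable_iff _).mpr (T.isGluable_ofModule F)

/-- The dimensions `dim Extⁿ(ΦF, ΦF) = dim Extⁿ(F, F)` for a sheaf `F` moved by an exact equivalence (how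
the cell reads `Extⁱ(E₀, E₀) = Extⁱ(I_Z, I_Z)`). [cite: Orlov2002DerivedAbelian, p. 3 L33–40] -/
theorem finrank_ext_ofModule (n : ℤ) (F : Y₁.left.Modules) :
    Module.finrank ℂ (D.Ext n (Φ.toFun (T.ofModule F)) (Φ.toFun (T.ofModule F))) =
      Module.finrank ℂ (D.Ext n (T.ofModule F) (T.ofModule F)) :=
  Φ.finrank_ext_eq n _ _

/-- The inverse of an exact equivalence is an exact equivalence. [cite: Orlov2002DerivedAbelian, p. 3 L28–40] -/
def symm : PerfEquivalence D T Y₂ Y₁ where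
  toFun := Φ.invFun
  invFun := Φ.toFun
  left_inv := Φ.right_inv
  right_inv := Φ.left_inv
  map_shift a F := by
    apply Φ.toEquiv.injective
    change Φ.toFun _ = Φ.toFun _
    rw [Φ.map_shift, Φ.right_inv, Φ.right_inv]
  extMap n F G :=
    (extCongr n (Φ.right_inv F) (Φ.right_inv G)).symm.trans (Φ.extMap n (Φ.invFun F) (Φ.invFun G)).symm

/-- Exact equivalences compose. [cite: Orlov2002DerivedAbelian, p. 3 L28–40 and Assertion 2.8 (proof)] -/
def trans (Ψ : PerfEquivalence D T Y₂ Y₃) : PerfEquivalence D T Y₁ Y₃ where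
  toFun E := Ψ.toFun (Φ.toFun E)
  invFun G := Φ.invFun (Ψ.invFun G)
  left_inv E := by simp only [Ψ.left_inv, Φ.left_inv]
  right_inv G := by simp only [Φ.right_inv, Ψ.right_inv]
  map_shift a E := by simp only [Φ.map_shift, Ψ.map_shift]
  extMap n E F := (Φ.extMap n E F).trans (Ψ.extMap n _ _)

/-- The identity is an exact equivalence. [folklore] -/
def refl (T : DerivedShiftData D) (Y : SchemeOver ℂ) : PerfEquivalence D T Y Y where
  toFun E := E
  invFun E := E
  left_inv _ := rfl
  right_inv _ := rfl
  map_shift _ _ := rfl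
  extMap _ _ _ := LinearEquiv.refl ℂ _

end PerfEquivalence

end Literature.AlgebraicGeometry.AbelianVarieties

end
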